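import Summits.SmoothPoincare4.SmoothPoincare4.Theorems.SullivanDualWitnessChargeV15CapModelTopology
import Literature.Geometry.Symplectic.JSphereFamilyLeafFunction

/-!
# Cap model for crux `WitnessCharge`, II: charts, the embedding `ι = inl`, the cap chart

Sequel to `…V15CapModelGlue.lean` (stub `stub_capModel` of skeleton v15, line `Sketch`, lead c8).
For the glued manifold `X = (Σ ∖ p) ∪_glue capDisc ρ` of `capGlueData`:

* `chartAt_inl`: the preferred chart of `X` at `inl a` is the lift of the preferred chart of
  `Σ ∖ p` at `a`, whence `hasMFDerivAt_inl : dι = id` and the computation of `extChartAt`;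
* `capIotaInv` — a left inverse of `inl`, smooth on `range inl` with `d(capIotaInv) = id` there;
* the cap chart: `capPtMap σ = inr (0, σ)`, `capInvMap (t, σ) = inr (t, σ)` (`‖t‖ < ρ`),
  `capCoordMap (inr b) = b`; their algebra (`capCoordMap ∘ capInvMap = id`, the two descriptions
  `capInvMap (z⁻¹, w) = inl x` of the overlap), smoothness, and the differential identities
  `d(capCoordMap) ∘ d(capInvMap) = id`, `d(capInvMap)` bijective.

The almost complex structure and the assembly of `CapData` follow in the sequel files.
-/

noncomputable section

set_option linter.dupNamespace false

open scoped Manifold ContDiff Topology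
open Set Filter Function Literature.Geometry.Symplectic Literature.Topology.FourManifolds
  TopologicalSpace

namespace Summit.SmoothPoincare4.SmoothPoincare4.Theorems.WitnessCharge.PencilIncompleteness

variable {S : HomotopySphere 4} {p : S.carrier} {ε' : ℝ}
variable (hε' : 0 < ε')
  (hball : Metric.closedBall (extChartAt (𝓡 4) p p) ε' ⊆ (extChartAt (𝓡 4) p).target)

/-! ### The preferred charts of the glued space at points of `Σ ∖ p` -/

/-- The preferred chart of `X` at `inl a` is the lift `chartA (chartAt a)`. -/
theorem chartAt_inl (a : punctured p) :
    chartAt (EuclideanSpace ℝ (Fin 4)) ((capGlueData hε' hball).inl a) =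
      (capGlueData hε' hball).chartA (chartAt (EuclideanSpace ℝ (Fin 4)) a) := by
  classical
  set d := capGlueData hε' hball
  have h : ∃ a', d.inl a' = d.inl a := ⟨a, rfl⟩
  have hc : Classical.choose h = a := d.inl_injective (Classical.choose_spec h)
  change dite (∃ a', d.inl a' = d.inl a)
      (fun h => d.chartA (chartAt (EuclideanSpace ℝ (Fin 4)) (Classical.choose h)))
      (fun h => d.chartB (chartAt (ℂ × ℂ)
        (Classical.choose ((d.exists_inl_or_inr (d.inl a)).resolve_left h)))) = _
  rw [dif_pos h, hc]

/-- The preferred chart of `X` at `inr b ∉ range inl` is the lift `chartB (chartAt b)`. -/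
theorem chartAt_inr_of_not_mem {b : capDisc (capRadius ε')}
    (hb : (capGlueData hε' hball).inr b ∉ range (capGlueData hε' hball).inl) :
    chartAt (EuclideanSpace ℝ (Fin 4)) ((capGlueData hε' hball).inr b) =
      (capGlueData hε' hball).chartB (chartAt (ℂ × ℂ) b) := by
  classical
  set d := capGlueData hε' hball
  have h : ¬ ∃ a', d.inl a' = d.inr b := fun ⟨a', ha'⟩ => hb ⟨a', ha'⟩
  have hc : Classical.choose ((d.exists_inl_or_inr (d.inr b)).resolve_left h) = b :=
    d.inr_injective (Classical.choose_spec ((d.exists_inl_or_inr (d.inr b)).resolve_left h))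
  change dite (∃ a', d.inl a' = d.inr b)
      (fun h => d.chartA (chartAt (EuclideanSpace ℝ (Fin 4)) (Classical.choose h)))
      (fun h => d.chartB (chartAt (ℂ × ℂ)
        (Classical.choose ((d.exists_inl_or_inr (d.inr b)).resolve_left h)))) = _
  rw [dif_neg h, hc]

/-- The lifted chart `chartA e` on points of `Σ ∖ p`: `chartA e (inl a') = e a'`. -/
theorem chartA_inl_apply (e : OpenPartialHomeomorph (punctured p) (EuclideanSpace ℝ (Fin 4)))
    (a' : punctured p) : (capGlueData hε' hball).chartA e ((capGlueData hε' hball).inl a') = e a' := by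
  rw [SmoothGlueData.chartA_apply_inl, capGlueData_linA, ContinuousLinearEquiv.refl_apply,
    modelWithCornersSelf_coe, id_eq]

/-- The extended chart of `X` at `inl a`, on points of `Σ ∖ p`, is the extended chart of `Σ ∖ p` at `a`. -/
theorem extChartAt_inl_apply (a a' : punctured p) :
    extChartAt (𝓡 4) ((capGlueData hε' hball).inl a) ((capGlueData hε' hball).inl a') =
      extChartAt (𝓡 4) a a' := by
  simp only [extChartAt, OpenPartialHomeomorph.extend_coe, comp_apply, modelWithCornersSelf_coe,
    id_eq, chartAt_inl, chartA_inl_apply]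

/-- The source of the extended chart of `X` at `inl a` is `inl '' (chartAt a).source`. -/
theorem extChartAt_inl_source (a : punctured p) :
    (extChartAt (𝓡 4) ((capGlueData hε' hball).inl a)).source =
      (capGlueData hε' hball).inl '' (chartAt (EuclideanSpace ℝ (Fin 4)) a).source := by
  rw [extChartAt_source, chartAt_inl, SmoothGlueData.chartA_source]

/-- **`dι = id`**: the inclusion `inl : Σ ∖ p → X` has the identity as differential (in the
preferred charts, which are the same chart on both sides). -/
theorem hasMFDerivAt_inl (a : punctured p) :
    HasMFDerivAt (𝓡 4) (𝓡 4) (capGlueData hε' hball).inl a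
      (ContinuousLinearMap.id ℝ (EuclideanSpace ℝ (Fin 4))) := by
  set d := capGlueData hε' hball
  refine ⟨d.continuous_inl.continuousAt, ?_⟩
  have hev : writtenInExtChartAt (𝓡 4) (𝓡 4) a d.inl =ᶠ[𝓝[range (𝓡 4)] (extChartAt (𝓡 4) a a)] id := by
    have hopen : IsOpen (extChartAt (𝓡 4) a).target := by
      rw [extChartAt_target]
      simpa using (chartAt (EuclideanSpace ℝ (Fin 4)) a).open_target
    have hmem : (extChartAt (𝓡 4) a).target ∈ 𝓝[range (𝓡 4)] (extChartAt (𝓡 4) a a) :=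
      mem_nhdsWithin_of_mem_nhds (hopen.mem_nhds (mem_extChartAt_target a))
    filter_upwards [hmem] with v hv
    simp only [writtenInExtChartAt, comp_apply, id_eq]
    rw [extChartAt_inl_apply, (extChartAt (𝓡 4) a).right_inv hv]
  refine (hasFDerivWithinAt_id _ _).congr_of_eventuallyEq hev ?_
  show extChartAt (𝓡 4) (d.inl a) (d.inl ((extChartAt (𝓡 4) a).symm (extChartAt (𝓡 4) a a))) =
    id (extChartAt (𝓡 4) a a)
  rw [(extChartAt (𝓡 4) a).left_inv (mem_extChartAt_source a), extChartAt_inl_apply, id_eq]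

/-- `mfderiv ι = id`. -/
theorem mfderiv_inl (a : punctured p) :
    mfderiv (𝓡 4) (𝓡 4) (capGlueData hε' hball).inl a =
      ContinuousLinearMap.id ℝ (EuclideanSpace ℝ (Fin 4)) :=
  (hasMFDerivAt_inl hε' hball a).mfderiv

/-! ### A left inverse of `inl` -/

include hε' hball in
/-- `Σ ∖ p` is nonempty (it contains the far flat points of the chart at `p`). -/
theorem nonempty_punctured : Nonempty (punctured p) :=
  ⟨farLine hε' hball (inv_lt_norm_far hε') 0⟩

/-- A left inverse `X → Σ ∖ p` of `inl` (arbitrary off `range inl`). -/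
def capIotaInv (y : (capGlueData hε' hball).Glued) : punctured p := by
  classical
  exact if h : ∃ x, (capGlueData hε' hball).inl x = y then Classical.choose h
    else Classical.choice (nonempty_punctured hε' hball)

/-- `capIotaInv (inl x) = x`. -/
@[simp] theorem capIotaInv_inl (x : punctured p) :
    capIotaInv hε' hball ((capGlueData hε' hball).inl x) = x := by
  classical
  have h : ∃ x', (capGlueData hε' hball).inl x' = (capGlueData hε' hball).inl x := ⟨x, rfl⟩
  rw [capIotaInv, dif_pos h]
  exact (capGlueData hε' hball).inl_injective (Classical.choose_spec h)

/-- `capIotaInv ∘ inl = id`. -/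
theorem capIotaInv_comp_inl : capIotaInv hε' hball ∘ (capGlueData hε' hball).inl = id :=
  funext (capIotaInv_inl hε' hball)

/-- `capIotaInv` is smooth on `range inl`. -/
theorem contMDiffOn_capIotaInv :
    ContMDiffOn (𝓡 4) (𝓡 4) ∞ (capIotaInv hε' hball) (range (capGlueData hε' hball).inl) := by
  rintro _ ⟨x, rfl⟩
  refine ContMDiffAt.contMDiffWithinAt ?_
  rw [SmoothGlueData.contMDiffAt_inl_iff, capIotaInv_comp_inl]
  exact contMDiffAt_id

/-- `d(capIotaInv) = id` at points of `range inl`. -/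
theorem hasMFDerivAt_capIotaInv (x : punctured p) :
    HasMFDerivAt (𝓡 4) (𝓡 4) (capIotaInv hε' hball) ((capGlueData hε' hball).inl x)
      (ContinuousLinearMap.id ℝ (EuclideanSpace ℝ (Fin 4))) := by
  set d := capGlueData hε' hball
  have hdiff : MDifferentiableAt (𝓡 4) (𝓡 4) (capIotaInv hε' hball) (d.inl x) :=
    ((contMDiffOn_capIotaInv hε' hball).contMDiffAt
      (d.isOpen_range_inl.mem_nhds ⟨x, rfl⟩)).mdifferentiableAt (by simp)
  have hcomp : mfderiv (𝓡 4) (𝓡 4) (capIotaInv hε' hball ∘ d.inl) x =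
      (mfderiv (𝓡 4) (𝓡 4) (capIotaInv hε' hball) (d.inl x)).comp
        (mfderiv (𝓡 4) (𝓡 4) d.inl x) :=
    mfderiv_comp x hdiff (hasMFDerivAt_inl hε' hball x).mdifferentiableAt
  rw [capIotaInv_comp_inl, mfderiv_id, mfderiv_inl] at hcomp
  have heq : mfderiv (𝓡 4) (𝓡 4) (capIotaInv hε' hball) (d.inl x) =
      ContinuousLinearMap.id ℝ (EuclideanSpace ℝ (Fin 4)) := by
    ext v
    exact (congrArg (fun L : EuclideanSpace ℝ (Fin 4) →L[ℝ] EuclideanSpace ℝ (Fin 4) => L v)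
      hcomp).symm
  exact heq ▸ hdiff.hasMFDerivAt

/-! ### The cap chart -/

/-- The added line `E`: `capPtMap σ = inr (0, σ)`. -/
def capPtMap (σ : ℂ) : (capGlueData hε' hball).Glued :=
  (capGlueData hε' hball).inr ⟨(0, σ), by simp [capRadius_pos hε']⟩

/-- The inverse cap chart `(t, σ) ↦ inr (t, σ)` for `‖t‖ < ρ` (and `inr (0, 0)` otherwise). -/
def capInvMap (q : ℂ × ℂ) : (capGlueData hε' hball).Glued := by
  classical
  exact if h : ‖q.1‖ < capRadius ε' then (capGlueData hε' hball).inr ⟨q, h⟩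
    else (capGlueData hε' hball).inr ⟨(0, 0), by simp [capRadius_pos hε']⟩

/-- The cap coordinates `inr b ↦ b` (and `0` off `range inr`). -/
def capCoordMap (y : (capGlueData hε' hball).Glued) : ℂ × ℂ := by
  classical
  exact if h : ∃ b, (capGlueData hε' hball).inr b = y then
      ((Classical.choose h : capDisc (capRadius ε')) : ℂ × ℂ) else 0

/-- `capInvMap q = inr q` for `‖q.1‖ < ρ`. -/
theorem capInvMap_of_lt {q : ℂ × ℂ} (hq : ‖q.1‖ < capRadius ε') :
    capInvMap hε' hball q = (capGlueData hε' hball).inr ⟨q, hq⟩ := by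
  classical
  rw [capInvMap, dif_pos hq]

/-- `capCoordMap (inr b) = b`. -/
@[simp] theorem capCoordMap_inr (b : capDisc (capRadius ε')) :
    capCoordMap hε' hball ((capGlueData hε' hball).inr b) = b := by
  classical
  have h : ∃ b', (capGlueData hε' hball).inr b' = (capGlueData hε' hball).inr b := ⟨b, rfl⟩
  rw [capCoordMap, dif_pos h]
  exact congrArg Subtype.val ((capGlueData hε' hball).inr_injective (Classical.choose_spec h))

/-- `capCoordMap ∘ capInvMap = id` on the cap disc. -/
theorem capCoordMap_capInvMap {q : ℂ × ℂ} (hq : ‖q.1‖ < capRadius ε') :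
    capCoordMap hε' hball (capInvMap hε' hball q) = q := by
  rw [capInvMap_of_lt hε' hball hq, capCoordMap_inr]

/-- `capInvMap (0, σ) = capPtMap σ`. -/
theorem capInvMap_zero (σ : ℂ) : capInvMap hε' hball (0, σ) = capPtMap hε' hball σ := by
  rw [capInvMap_of_lt hε' hball (by simp [capRadius_pos hε'])]
  rfl

/-- The image of the cap disc under `capInvMap` is `range inr`. -/
theorem capInvMap_image :
    capInvMap hε' hball '' {q : ℂ × ℂ | ‖q.1‖ < capRadius ε'} = range (capGlueData hε' hball).inr := by
  ext y
  constructor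
  · rintro ⟨q, hq, rfl⟩
    exact ⟨⟨q, hq⟩, (capInvMap_of_lt hε' hball hq).symm⟩
  · rintro ⟨b, rfl⟩
    exact ⟨b, b.2, by rw [capInvMap_of_lt hε' hball b.2]⟩

/-- The cap chart domain `range inr` is open. -/
theorem isOpen_capInvMap_image :
    IsOpen (capInvMap hε' hball '' {q : ℂ × ℂ | ‖q.1‖ < capRadius ε'}) := by
  rw [capInvMap_image]
  exact (capGlueData hε' hball).isOpen_range_inr

/-- **The overlap from the cap side**: for `0 < ‖t‖ < ρ`, `capInvMap (t, σ) = inl x`, `Ycoord p x = (t⁻¹, σ)`. -/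
theorem capInvMap_flat {q : ℂ × ℂ} (hq : ‖q.1‖ < capRadius ε') (hq0 : q.1 ≠ 0) :
    ∃ x : punctured p, capInvMap hε' hball q = (capGlueData hε' hball).inl x ∧
      InPuncturedChartBall p ε' x ∧ Ycoord p x = (q.1⁻¹, q.2) := by
  set d := capGlueData hε' hball
  have hb : (⟨q, hq⟩ : capDisc (capRadius ε')) ∈ (capGlue hε' hball).target :=
    (mem_capGlue_target_iff hε' hball _).2 hq0
  refine ⟨(capGlue hε' hball).symm ⟨q, hq⟩, ?_, ?_, ?_⟩
  · rw [capInvMap_of_lt hε' hball hq]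
    exact (d.inl_glue_symm hb).symm
  · have := (capGlue hε' hball).map_target hb
    rw [mem_capGlue_source_iff] at this
    exact this.1
  · have h1 := capGlue_apply_coe hε' hball _ ((capGlue hε' hball).map_target hb)
    rw [(capGlue hε' hball).right_inv hb] at h1
    -- `h1 : q = ((z)⁻¹, w)` for the point `x = glue.symm q`
    have hz : (Ycoord p ((capGlue hε' hball).symm ⟨q, hq⟩)).1 = q.1⁻¹ := by
      have := congrArg Prod.fst h1
      simp only at this
      rw [this, inv_inv]
    have hw : (Ycoord p ((capGlue hε' hball).symm ⟨q, hq⟩)).2 = q.2 := by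
      have := congrArg Prod.snd h1
      simpa using this.symm
    exact Prod.ext hz hw

/-- **The overlap from the flat side**: a point of the `ε'`-ball with `ρ⁻¹ < ‖z‖` is `capInvMap (z⁻¹, w)`. -/
theorem capInvMap_Ycoord {x : punctured p} (hx : InPuncturedChartBall p ε' x)
    (hz : (capRadius ε')⁻¹ < ‖(Ycoord p x).1‖) :
    capInvMap hε' hball (((Ycoord p x).1)⁻¹, (Ycoord p x).2) = (capGlueData hε' hball).inl x := by
  set d := capGlueData hε' hball
  have hxs : x ∈ (capGlue hε' hball).source := (mem_capGlue_source_iff hε' hball x).2 ⟨hx, hz⟩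
  have hρ := capRadius_pos hε'
  have hzpos : 0 < ‖(Ycoord p x).1‖ := (inv_pos.2 hρ).trans hz
  have hq : ‖((((Ycoord p x).1)⁻¹, (Ycoord p x).2) : ℂ × ℂ).1‖ < capRadius ε' := by
    simpa [norm_inv] using (inv_lt_comm₀ hzpos hρ).2 hz
  rw [capInvMap_of_lt hε' hball hq]
  have hglue : capGlue hε' hball x = ⟨(((Ycoord p x).1)⁻¹, (Ycoord p x).2), hq⟩ :=
    Subtype.ext (capGlue_apply_coe hε' hball x hxs)
  rw [← hglue]
  exact d.inr_glue hxs

/-- A point `inr b` is of the form `inl x` iff `b` is off the line `t = 0`. -/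
theorem inr_mem_range_inl_iff (b : capDisc (capRadius ε')) :
    (capGlueData hε' hball).inr b ∈ range (capGlueData hε' hball).inl ↔ (b : ℂ × ℂ).1 ≠ 0 := by
  rw [SmoothGlueData.inr_mem_range_inl_iff, capGlueData_glue, mem_capGlue_target_iff]

/-- `inl x ≠ capPtMap σ`: `Σ ∖ p` misses the added line. -/
theorem inl_ne_capPtMap (x : punctured p) (σ : ℂ) :
    (capGlueData hε' hball).inl x ≠ capPtMap hε' hball σ := by
  intro h
  have : capPtMap hε' hball σ ∈ range (capGlueData hε' hball).inl := ⟨x, h⟩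
  rw [capPtMap, inr_mem_range_inl_iff] at this
  exact this rfl

/-- `capPtMap` is injective. -/
theorem capPtMap_injective : Function.Injective (capPtMap hε' hball) := by
  intro σ σ' h
  have := congrArg Subtype.val ((capGlueData hε' hball).inr_injective h)
  simpa using this

/-- Every point of `X` is in `range inl` or on the added line. -/
theorem range_inl_union_range_capPtMap :
    range (capGlueData hε' hball).inl ∪ range (capPtMap hε' hball) = univ := by
  set d := capGlueData hε' hball
  refine eq_univ_of_forall fun y => ?_
  obtain (⟨a, rfl⟩ | ⟨b, rfl⟩) := d.exists_inl_or_inr y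
  · exact Or.inl ⟨a, rfl⟩
  · by_cases hb : (b : ℂ × ℂ).1 = 0
    · refine Or.inr ⟨(b : ℂ × ℂ).2, ?_⟩
      rw [capPtMap]
      congr 1
      exact Subtype.ext (Prod.ext hb.symm rfl)
    · exact Or.inl ((inr_mem_range_inl_iff hε' hball b).2 hb)

/-! ### Smoothness of the cap chart and its differential -/

/-- The corestriction `ℂ × ℂ ⇀ capDisc ρ` (inverse of the coercion) is smooth on the cap disc. -/
theorem contMDiffOn_capCoe_symm :
    ContMDiffOn 𝓘(ℝ, ℂ × ℂ) 𝓘(ℝ, ℂ × ℂ) ∞ (capCoe hε').symm {q : ℂ × ℂ | ‖q.1‖ < capRadius ε'} := by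
  intro q hq
  rw [← ContMDiffWithinAt.subtypeVal_comp_iff]
  refine (contMDiffWithinAt_id).congr (fun q' hq' => ?_) ?_
  · exact capCoe_symm_coe hε' hq'
  · exact capCoe_symm_coe hε' hq

/-- `capInvMap` is smooth on the cap disc. -/
theorem contMDiffOn_capInvMap :
    ContMDiffOn 𝓘(ℝ, ℂ × ℂ) (𝓡 4) ∞ (capInvMap hε' hball) {q : ℂ × ℂ | ‖q.1‖ < capRadius ε'} := by
  have h : ContMDiffOn 𝓘(ℝ, ℂ × ℂ) (𝓡 4) ∞ ((capGlueData hε' hball).inr ∘ (capCoe hε').symm)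
      {q : ℂ × ℂ | ‖q.1‖ < capRadius ε'} :=
    (capGlueData hε' hball).contMDiff_inr.comp_contMDiffOn (contMDiffOn_capCoe_symm hε')
  refine h.congr fun q hq => ?_
  rw [capInvMap_of_lt hε' hball hq, comp_apply]
  congr 1
  exact Subtype.ext (capCoe_symm_coe hε' hq).symm

/-- `capInvMap` is smooth at every point of the (open) cap disc. -/
theorem contMDiffAt_capInvMap {q : ℂ × ℂ} (hq : ‖q.1‖ < capRadius ε') :
    ContMDiffAt 𝓘(ℝ, ℂ × ℂ) (𝓡 4) ∞ (capInvMap hε' hball) q :=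
  (contMDiffOn_capInvMap hε' hball).contMDiffAt ((capDisc (capRadius ε')).2.mem_nhds hq)

/-- `capCoordMap` is smooth on the cap chart domain `range inr`. -/
theorem contMDiffOn_capCoordMap :
    ContMDiffOn (𝓡 4) 𝓘(ℝ, ℂ × ℂ) ∞ (capCoordMap hε' hball)
      (capInvMap hε' hball '' {q : ℂ × ℂ | ‖q.1‖ < capRadius ε'}) := by
  rw [capInvMap_image]
  rintro _ ⟨b, rfl⟩
  refine ContMDiffAt.contMDiffWithinAt ?_
  rw [SmoothGlueData.contMDiffAt_inr_iff]
  have : capCoordMap hε' hball ∘ (capGlueData hε' hball).inr = Subtype.val :=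
    funext fun b' => capCoordMap_inr hε' hball b'
  rw [this]
  exact contMDiff_subtype_val.contMDiffAt

/-- `capCoordMap` is smooth at every point of the cap chart domain. -/
theorem contMDiffAt_capCoordMap {q : ℂ × ℂ} (hq : ‖q.1‖ < capRadius ε') :
    ContMDiffAt (𝓡 4) 𝓘(ℝ, ℂ × ℂ) ∞ (capCoordMap hε' hball) (capInvMap hε' hball q) :=
  (contMDiffOn_capCoordMap hε' hball).contMDiffAt
    ((isOpen_capInvMap_image hε' hball).mem_nhds ⟨q, hq, rfl⟩)

/-- `capPtMap` is smooth. -/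
theorem contMDiff_capPtMap : ContMDiff 𝓘(ℝ, ℂ) (𝓡 4) ∞ (capPtMap hε' hball) := by
  have h1 : ContMDiff 𝓘(ℝ, ℂ) 𝓘(ℝ, ℂ × ℂ) ∞ (fun σ : ℂ => ((0 : ℂ), σ)) := by
    rw [contMDiff_iff_contDiff]
    exact contDiff_const.prodMk contDiff_id
  have h2 : ContMDiff 𝓘(ℝ, ℂ) (𝓡 4) ∞ (capInvMap hε' hball ∘ fun σ : ℂ => ((0 : ℂ), σ)) :=
    fun σ => (contMDiffAt_capInvMap hε' hball (q := ((0 : ℂ), σ))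
      (by simp [capRadius_pos hε'])).comp σ (h1 σ)
  refine h2.congr fun σ => ?_
  exact (capInvMap_zero hε' hball σ).symm

/-- **`d(capCoordMap) ∘ d(capInvMap) = id`** on the cap disc. -/
theorem mfderiv_capCoordMap_comp {q : ℂ × ℂ} (hq : ‖q.1‖ < capRadius ε') :
    (mfderiv (𝓡 4) 𝓘(ℝ, ℂ × ℂ) (capCoordMap hε' hball) (capInvMap hε' hball q)).comp
        (mfderiv 𝓘(ℝ, ℂ × ℂ) (𝓡 4) (capInvMap hε' hball) q) =
      ContinuousLinearMap.id ℝ (ℂ × ℂ) := by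
  have hd1 : MDifferentiableAt 𝓘(ℝ, ℂ × ℂ) (𝓡 4) (capInvMap hε' hball) q :=
    (contMDiffAt_capInvMap hε' hball hq).mdifferentiableAt (by simp)
  have hd2 : MDifferentiableAt (𝓡 4) 𝓘(ℝ, ℂ × ℂ) (capCoordMap hε' hball) (capInvMap hε' hball q) :=
    (contMDiffAt_capCoordMap hε' hball hq).mdifferentiableAt (by simp)
  have hcomp := mfderiv_comp q hd2 hd1
  have hid : mfderiv 𝓘(ℝ, ℂ × ℂ) 𝓘(ℝ, ℂ × ℂ) (capCoordMap hε' hball ∘ capInvMap hε' hball) q =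
      ContinuousLinearMap.id ℝ (ℂ × ℂ) := by
    have hev : (capCoordMap hε' hball ∘ capInvMap hε' hball) =ᶠ[𝓝 q] id := by
      filter_upwards [(capDisc (capRadius ε')).2.mem_nhds hq] with q' hq'
      exact capCoordMap_capInvMap hε' hball hq'
    rw [hev.mfderiv_eq]
    exact mfderiv_id
  rw [← hcomp, hid]


/-- The preferred chart of an open subset of `ℂ × ℂ` (e.g. the cap disc) is the inclusion.
Registered helper of the crux (stub `stub_capModel`, file II). -/
theorem helper_capModel_chartAt_opens_apply :
    ∀ (U : TopologicalSpace.Opens (ℂ × ℂ)) (b₀ b : U), chartAt (ℂ × ℂ) b₀ b = (b : ℂ × ℂ) :=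
  fun _ _ _ => rfl

/-- **`d(capInvMap)` is bijective** on the cap disc (injective, between 4-dimensional spaces). -/
theorem mfderiv_capInvMap_bijective {q : ℂ × ℂ} (hq : ‖q.1‖ < capRadius ε') :
    Function.Bijective (mfderiv 𝓘(ℝ, ℂ × ℂ) (𝓡 4) (capInvMap hε' hball) q) := by
  set L := mfderiv 𝓘(ℝ, ℂ × ℂ) (𝓡 4) (capInvMap hε' hball) q
  have hinj : Function.Injective L := by
    intro v w h
    have := congrArg (mfderiv (𝓡 4) 𝓘(ℝ, ℂ × ℂ) (capCoordMap hε' hball) (capInvMap hε' hball q)) h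
    have h2 := mfderiv_capCoordMap_comp hε' hball hq
    have hv := congrArg (fun T : ℂ × ℂ →L[ℝ] ℂ × ℂ => T v) h2
    have hw := congrArg (fun T : ℂ × ℂ →L[ℝ] ℂ × ℂ => T w) h2
    simp only [ContinuousLinearMap.id_apply] at hv hw
    rw [← hv, ← hw]
    exact this
  refine ⟨hinj, ?_⟩
  exact (LinearMap.injective_iff_surjective_of_finrank_eq_finrank
    (Literature.Geometry.Symplectic.finrank_complex_prod)).1 hinj

end Summit.SmoothPoincare4.SmoothPoincare4.Theorems.WitnessCharge.PencilIncompleteness
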